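/-
Copyright (c) 2026 the pub-hodgecm-mathlib formalisation cell (harness21).  Prover seat hodgecm-mathlib-K2E3-p04 (g3), Track B ∕ K2-LIT
(build stream 29), h413 = `stmt-HodgeConjecture-24833`, line `K2_E3_EllipticInputs`, unit U4 «Keys» — brick I-4c «U4-f ON THE UNRAMIFIED LINE REDUCES TO ROAD II'S NUMBER,
AT EVERY NON-SPLIT PLACE AND FOR EVERY `χ₂`».  2026-09-04.
-/
import Summits.HodgeConjecture.HodgeConjecture.Theorems.K2E3SphericalReducibilityJunctionNonsplit   -- ★ p857014 (this base, g3): the junction at every non-split place (organ currency)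
import Summits.HodgeConjecture.HodgeConjecture.Theorems.K2E3PrincipalSeriesDetTwist               -- ★ p857080 (this base, g3): `i_G(χ₁,χ₂)` reducible ⟺ `i_G(χ₁,1)` reducible
import HarnessLib

/-!
# h413 ∕ Track B «K2-LIT», unit U4 «Keys», brick I-4c: U4-f `sig_K2E3KeysThmTwoContracting` ON THE UNRAMIFIED LINE — «`i_G(χ₁, χ₂)` reducible, `χ₁` unramified contracting» ⟹
# «every `G`-map `B : i_G(χ̄₁⁻¹, 1) → i_G(χ₁, 1)` kills the spherical vector at `1`», at EVERY non-split place and for EVERY `χ₂`   [Keys1984 §7 Thm (2); Rogawski1990 §12.2; Casselman1995 §6.4]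

Cell `pub/hodgecm-mathlib`, crux H413 = `stmt-HodgeConjecture-24833` (lane `--supports … --as helper`), route HCCMUnconditional; dealer K2E3-plan (g2).  THEOREMS ONLY (0 def ∕ 0 instance ∕
0 notation ∕ 0 sorry); ★-only imports.  This is the HAND-OVER STATEMENT from road I (this base: the intertwining integral `J(w, χ)`, Macdonald's `c_w(χ)` at every non-split place
★ p856802 ∕ p856958, the junction ★ p857014, the det-twist ★ p857080) to road II (K2E3-p05: the Iwahori line, which computes the number `(B f'_K)(1)`): with it, U4-f for an UNRAMIFIED
`χ₁` and ANY `χ₂` at ANY non-split place is the single implication «`(B f'_K)(1) = 0` ⇒ `χ₁(ϖ) ∈ {q_F⁻², −q_F⁻¹}` (inert) ∕ `{q_F⁻¹}` (ramified)» on `i_G(χ₁, 1)`.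

* §1 **`cmTorusCharPair_one_eq_one_of_unramified`** — `χ₁ = 1` on `𝒪_vˣ` ⇒ `(χ₁, 1)` is trivial on `T ∩ K_v` (converse of ★ p856288 (H1); the torus chart ★ `torusChart_torusCoords`).
* §2 **`forall_counterIntertwiner_eval_eq_zero_of_reducible_of_unramified`** — the hand-over statement above.
What it does NOT cover: ramified `χ₁` (conductor ≥ 1; Keys §4–§6, acq-15210) — there `i_G(χ₁, 1)` has no `K_v`-fixed vector and road I's spherical line is empty.

HONEST LABEL.  HC_CM is proved only modulo the 7 printed citations (2 remaining named inputs: hLiu418 = `stmt-HodgeConjecture-24832`, h413 = `stmt-HodgeConjecture-24833`) until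
rung 0 closes; count-neutral (U4 helper).

## References
* [Keys1984] D. Keys, *Principal series representations of special unitary groups over local fields*, Compositio Math. 51 (1984), §3, §7 Thm (2) p. 126.
* [Rogawski1990] J. D. Rogawski, *Automorphic Representations of Unitary Groups in Three Variables*, Ann. of Math. Stud. 123 (1990), §12.1 p. 171, §12.2 (1)–(2) p. 173, §4.5 p. 45.
* [Casselman1995] W. Casselman, *Introduction to the theory of admissible representations of `p`-adic reductive groups* (1995), §6.4 pp. 62–64, Thm. 6.6.2 p. 66.
* [CartierCorvallis1979] P. Cartier, *Representations of `p`-adic groups: a survey*, Proc. Symp. Pure Math. 33 (1979), §IV.1 (spherical vectors, unramified characters).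
-/

set_option autoImplicit false
-- the mandated namespace repeats the single-problem summit's segment (`HodgeConjecture.HodgeConjecture`)
set_option linter.dupNamespace false

noncomputable section

open NumberField IsDedekindDomain MeasureTheory
open scoped Matrix NNReal ENNReal

open Literature.NumberTheory Literature.NumberTheory.Automorphic Literature.NumberTheory.Automorphic.UnitaryGroup
open Literature.NumberTheory.GaloisRepresentations Literature.NumberTheory.GaloisRepresentations.IsNonarchimedeanLocalField

namespace Summit.HodgeConjecture.HodgeConjecture.Cruxes.H413.K2E3KeysThmTwoUnramifiedLineReduction

variable (L : Type) [Field L] [NumberField L] [IsCMField L] (v : HeightOneSpectrum (𝓞 ↥(maximalRealSubfield L)))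

/-! ## §1 «`χ₁` unramified» ⇒ «`(χ₁, 1)` trivial on `T ∩ K_v`» (the converse of ★ p856288 (H1)) -/

set_option synthInstance.maxHeartbeats 400000 in
set_option maxHeartbeats 3200000 in
-- the torus chart on the matrix carrier (class of ★ `K2E3SphericalCFunctionOrganCurrency.trivial_weyl_of_trivial`)
/-- **If `χ₁ = 1` on `𝒪_vˣ = (Π_w 𝒪_w)ˣ` then `χ = (χ₁, 1)` is trivial on `T ∩ K_v`** (`v` non-split): `t = ι(α, z)` (★ `torusChart_torusCoords`), `t ∈ K_v ⟺ α ∈ 𝒪_vˣ`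
(★ `torusChart_mem_cmLocalIntegralLevel_iff`), `χ(ι(α, z)) = χ₁(α)·1` (★ `cmTorusCharPair_torusChart`).  This is the `hχK` input of ★ `exists_sphericalVector` ∕ ★ p857014 §2 for the
twist-reduced character `(χ₁, 1)`. [cite: Rogawski1990, §12.1 p. 171; §12.2 p. 173] [cite: CartierCorvallis1979, §IV.1] -/
theorem cmTorusCharPair_one_eq_one_of_unramified (hns : ∀ w : PlacesOver L v, IsCMField.complexConj L • w.1 = w.1) (χ₁ : (LocalRing L v)ˣ →* ℂˣ)
    (hunr : ∀ u ∈ (Submonoid.pi Set.univ (fun w : PlacesOver L v => (w.1.adicCompletionIntegers L).toSubring.toSubmonoid)).units, χ₁ u = 1) :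
    ∀ t : ↥(torusU (conjLocal L (IsCMField.complexConj L) v) (cmLocalForm L 3 v)),
      (t : ↥(unitaryGroupOfForm (conjLocal L (IsCMField.complexConj L) v) (cmLocalForm L 3 v))) ∈
          cmLocalIntegralLevel L 3 (Matrix.of fun i j : Fin 3 => if i.val + j.val + 1 = 3 then (1 : L) else 0) v →
        cmTorusCharPair L v χ₁ 1 t = 1 := by
  intro t ht
  rw [← F0P3cStCharTSTorusChartIso.torusChart_torusCoords L v t] at ht ⊢
  have hm := (F0P3cStCharTSTorusChartIso.torusChart_mem_cmLocalIntegralLevel_iff L v hns _).1 ht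
  rw [F0P3cStCharTSTorusDefs.cmTorusCharPair_torusChart, MonoidHom.one_apply, mul_one]
  exact hunr _ (Subgroup.mem_prod.1 hm).1

/-! ## §2 U4-f on the unramified line is Road II's number -/

set_option synthInstance.maxHeartbeats 400000 in
set_option maxHeartbeats 8000000 in
-- statement∕proof over three `cmPrincipalSeries` carriers (class of ★ `K2E3SphericalReducibilityJunctionNonsplit.reducible_iff_forall_counterIntertwiner_eval_eq_zero_of_trivial`)
/-- **U4-f ON THE UNRAMIFIED LINE REDUCES TO THE VANISHING OF THE COUNTER-INTERTWINER ON THE SPHERICAL VECTOR OF `i_G(χ̄₁⁻¹, 1)`.**  `v` non-split (ANY ramification ∕ residue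
characteristic); `χ₁, χ₂` continuous (`χ₂` ARBITRARY), `χ₁` UNRAMIFIED (`= 1` on `𝒪_vˣ`) and CONTRACTING (U4-f's `hKpos`); **`i_G(χ₁, χ₂)` REDUCIBLE**; `w₀` of matrix `Φ₃`, `μ` Haar on `N(L⁺_v)`, `ϖ` a
uniformiser unit; `f_K ∈ i_G(χ₁, 1)^{K_v}`, `f'_K ∈ i_G(χ̄₁⁻¹, 1)^{K_v}` with `f_K(1) = f'_K(1) = 1` (both exist, ★ `exists_sphericalVector` + §1).  Then **every `G`-map `B : i_G(χ̄₁⁻¹, 1) → i_G(χ₁, 1)`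
has `(B f'_K)(1) = 0`** — ★ p857080 `reducible_iff_reducible_one` (drop `χ₂`) ∘ ★ p857014 §2 (the junction at every non-split place, organ currency) ∘ §1.  Road II computes this number
on the Iwahori line; its zero set in `z = χ₁(ϖ)` is Keys' list (inert: `z = q_F⁻²` or `−q_F⁻¹`; ramified: `z = q_F⁻¹`), i.e. `χ₁ = ‖·‖_E` or `η‖·‖_E^{1∕2}` — U4-f's conclusion.
[cite: Keys1984, §7 Thm (2)] [cite: Rogawski1990, §12.2 (1)–(2) p. 173] [cite: Casselman1995, Thm. 6.6.2 p. 66; §6.4] -/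
theorem forall_counterIntertwiner_eval_eq_zero_of_reducible_of_unramified (hns : ∀ w : PlacesOver L v, IsCMField.complexConj L • w.1 = w.1) (w : PlacesOver L v)
    (χ₁ : (LocalRing L v)ˣ →* ℂˣ) (χ₂ : ↥(normOneUnits (conjLocal L (IsCMField.complexConj L) v)) →* ℂˣ)
    (h₁ : Continuous fun x => ((χ₁ x : ℂˣ) : ℂ)) (h₂ : Continuous fun x => ((χ₂ x : ℂˣ) : ℂ))
    (hunr : ∀ u ∈ (Submonoid.pi Set.univ (fun w : PlacesOver L v => (w.1.adicCompletionIntegers L).toSubring.toSubmonoid)).units, χ₁ u = 1)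
    (hred : ∃ N : Subrepresentation (cmPrincipalSeries L 3 v (cmTorusCharPair L v χ₁ χ₂)), N ≠ ⊥ ∧ N ≠ ⊤)
    (hcontr : ∀ x : (LocalRing L v)ˣ, unitModulusChar (LocalRing L v) x < 1 → ‖((χ₁ x : ℂˣ) : ℂ)‖ < 1)
    (ϖ : (LocalRing L v)ˣ) (hϖ : ∀ w : PlacesOver L v, Valued.v ((ϖ : LocalRing L v) w) = WithZero.exp (-1 : ℤ))
    (w₀ : ↥(unitaryGroupOfForm (conjLocal L (IsCMField.complexConj L) v) (cmLocalForm L 3 v))) (hw₀ : Units.val (w₀ : GL (Fin 3) (LocalRing L v)) = cmLocalForm L 3 v)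
    [MeasurableSpace ↥(cmBorelTriple L 3 v).N] [BorelSpace ↥(cmBorelTriple L 3 v).N] (μ : Measure ↥(cmBorelTriple L 3 v).N) [μ.IsHaarMeasure]
    (fK : haveI := locallyCompactSpace_cmBorelU L 3 v
      Representation.SmoothInd (cmBorelTriple L 3 v).P (Representation.twist (((Representation.trivial ℂ ↥(torusU (conjLocal L (IsCMField.complexConj L) v) (cmLocalForm L 3 v)) ℂ).twist
        (cmTorusCharPair L v χ₁ 1)).comp (cmBorelTriple L 3 v).proj) (rootDeltaChar (cmBorelTriple L 3 v).P)))
    (hfK : haveI := locallyCompactSpace_cmBorelU L 3 v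
      fK ∈ (Representation.smoothIndRep (cmBorelTriple L 3 v).P _).fixedPoints (cmLocalIntegralLevel L 3 (Matrix.of fun i j : Fin 3 => if i.val + j.val + 1 = 3 then (1 : L) else 0) v)) (hK1 : fK.toFun 1 = 1)
    (fK' : haveI := locallyCompactSpace_cmBorelU L 3 v
      Representation.SmoothInd (cmBorelTriple L 3 v).P (Representation.twist (((Representation.trivial ℂ ↥(torusU (conjLocal L (IsCMField.complexConj L) v) (cmLocalForm L 3 v)) ℂ).twist
        (cmTorusCharPair L v (conjInvChar (conjLocal L (IsCMField.complexConj L) v) χ₁) 1)).comp (cmBorelTriple L 3 v).proj) (rootDeltaChar (cmBorelTriple L 3 v).P)))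
    (hfK' : haveI := locallyCompactSpace_cmBorelU L 3 v
      fK' ∈ (Representation.smoothIndRep (cmBorelTriple L 3 v).P _).fixedPoints (cmLocalIntegralLevel L 3 (Matrix.of fun i j : Fin 3 => if i.val + j.val + 1 = 3 then (1 : L) else 0) v))
    (hK'1 : fK'.toFun 1 = 1) :
    ∀ (B : (cmPrincipalSeries L 3 v (cmTorusCharPair L v (conjInvChar (conjLocal L (IsCMField.complexConj L) v) χ₁) 1)).IntertwiningMap (cmPrincipalSeries L 3 v (cmTorusCharPair L v χ₁ 1))), (B fK').toFun 1 = 0 := by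
  have hχK := cmTorusCharPair_one_eq_one_of_unramified L v hns χ₁ hunr
  have hred₁ := (K2E3PrincipalSeriesDetTwist.reducible_iff_reducible_one L v χ₁ χ₂ h₂).1 hred
  have h1c : Continuous fun x : ↥(normOneUnits (conjLocal L (IsCMField.complexConj L) v)) =>
      (((1 : ↥(normOneUnits (conjLocal L (IsCMField.complexConj L) v)) →* ℂˣ) x : ℂˣ) : ℂ) := by
    simp only [MonoidHom.one_apply, Units.val_one]
    exact continuous_const
  exact (K2E3SphericalReducibilityJunctionNonsplit.reducible_iff_forall_counterIntertwiner_eval_eq_zero_of_trivial L v hns w χ₁ 1 h₁ h1c hχK hcontr ϖ hϖ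
    w₀ hw₀ μ fK hfK hK1 fK' hfK' hK'1).1 hred₁

end Summit.HodgeConjecture.HodgeConjecture.Cruxes.H413.K2E3KeysThmTwoUnramifiedLineReduction

end
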